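import Summits.ResolutionOfSingularities.ResolutionOfSingularities.Theorems.RisoStrataRisoCentresResolvePCuspFamily
import Summits.ResolutionOfSingularities.ResolutionOfSingularities.Theorems.RisoStrataRisoCentresResolvePCuspNotRegular
import Summits.ResolutionOfSingularities.ResolutionOfSingularities.Theorems.RisoStrataDefs

/-!
# Route RisoStrata — crux `RisoCentresResolve` (stmt-ResolutionOfSingularities-18546), line `Sketch`:
# LETTERS COLLAPSE along the `p`-cusp family (registered sub-goal `pcusp_risoCen_le`; lead c2)

For the route's cut predicate `P B m d := ¬ Rtd B m (d + 1)` (written inline) the centre ideal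
`risoCen P B d` of EVERY letter `d` on the chart `B = k[x^p, y, xy]` (the toric surface
`w^p = u y^p`, char `p`) is contained in the maximal ideal of every point `u = c^p ≠ 0` of its
singular line: such a point is singular (`pcusp_not_isRegularLocalRing`, the worker-landed
non-normality) and has typed `rtd = 0` (`pcusp_not_rtd_one`), hence lies in the index set of
`risoCen P B d` for all `d ≥ 0`. So in characteristic `p` all letters of a riso schedule blow up
this whole curve (their centre is the reduced line), in contrast with characteristic `0` where the
letter `0` is zero-dimensional. Mathlib + tree only; no definitions, no named facts.
-/

noncomputable section

set_option linter.dupNamespace false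

namespace Summit.ResolutionOfSingularities.ResolutionOfSingularities.Theorems

open Summit.ResolutionOfSingularities.ResolutionOfSingularities.Theses.RisoStrata

/-- **Letters collapse at the points of the `p`-cusp family**: for every letter `d`, the centre
ideal `risoCen (fun B m d => ¬ Rtd B m (d+1)) B d` of `B = k[x^p, y, xy]` lies in the maximal ideal
`m` of each point `u = c^p ≠ 0` of the singular line (`m` is singular by
`pcusp_not_isRegularLocalRing` and has `¬ Rtd B m (d+1)` because already `¬ Rtd B m 1`,
`pcusp_not_rtd_one`). [folklore] -/
theorem pcusp_risoCen_le : ∀ (p : ℕ) [Fact p.Prime] (k : Type) [Field k] [CharP k p] (c : k), c ≠ 0 → ∀ (B : Subalgebra k (FractionRing (MvPolynomial (Fin 2) k))), B = Algebra.adjoin k {(algebraMap (MvPolynomial (Fin 2) k) (FractionRing (MvPolynomial (Fin 2) k)) (MvPolynomial.X 0)) ^ p, algebraMap (MvPolynomial (Fin 2) k) (FractionRing (MvPolynomial (Fin 2) k)) (MvPolynomial.X 1), algebraMap (MvPolynomial (Fin 2) k) (FractionRing (MvPolynomial (Fin 2) k)) (MvPolynomial.X 0) * algebraMap (MvPolynomial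 (Fin 2) k) (FractionRing (MvPolynomial (Fin 2) k)) (MvPolynomial.X 1)} → ∀ (m : Ideal ↥B), m.IsMaximal → (∀ b : ↥B, ((b : FractionRing (MvPolynomial (Fin 2) k)) = (algebraMap (MvPolynomial (Fin 2) k) (FractionRing (MvPolynomial (Fin 2) k)) (MvPolynomial.X 0)) ^ p - algebraMap k (FractionRing (MvPolynomial (Fin 2) k)) (c ^ p) ∨ (b : FractionRing (MvPolynomial (Fin 2) k)) = algebraMap (MvPolynomial (Fin 2) k) (FractionRing (MvPolynomial (Fin 2) k)) (MvPolynomial.X 1) ∨ (b : FractionRing (MvPolynomial (Fin 2) k)) = algebraMap (MvPolynomial (Fin 2) k) (FractionRing (MvPolynomial (Fin 2) k)) (MvPolynomial.X 0) * algebraMap (MvPolynomial (Fin 2) k) (FractionRing (MvPolynomial (Fin 2) k)) (MvPolynomial.X 1)) → b ∈ m) → ∀ d : ℕ, risoCen (fun (B : Subalgebra k (FractionRing (MvPolynomial (Fin 2) k))) (m : Ideal ↥B) (d : ℕ) => ¬ ∃ (n : ℕ) (g : Fin n → ↥B), (∀ i, g i ∈ m) ∧ Algebra.adjoin k (Set.range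 fun i => (g i : FractionRing (MvPolynomial (Fin 2) k))) = B ∧ ∃ W : Submodule k (Fin n → k), d + 1 ≤ Module.finrank k ↥W ∧ ∃ φ : {α : ↥B →ₐ[k] HahnSeries ℚ k // ∀ b ∈ m, 0 < (α b).orderTop} → (Fin n → HahnSeries ℚ k), (∀ a b : {α : ↥B →ₐ[k] HahnSeries ℚ k // ∀ b ∈ m, 0 < (α b).orderTop}, a ≠ b → ∃ j, ∀ i, (a.1 (g j) - b.1 (g j)).orderTop < ((φ a i - φ b i) - (a.1 (g i) - b.1 (g i))).orderTop) ∧ (∀ a i, 0 < (φ a i).orderTop) ∧ (∀ a, ∀ w : Fin n → HahnSeries ℚ k, (∀ i, 0 < (w i).orderTop) → w ∈ Submodule.span (HahnSeries ℚ k) ((fun u : Fin n → k => fun i => HahnSeries.C (u i)) '' (W : Set (Fin n → k))) → ∃ b, φ b = φ a + w)) B d ≤ m := by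
  intro p _ k _ _ c hc B hB m hm hPm d
  refine iInf₂_le m ⟨hm, pcusp_not_isRegularLocalRing p k c hc B hB m hm hPm, ?_⟩
  rintro ⟨n, g, hg, hgK, W, hW, φ, h1, h2, h3⟩
  exact pcusp_not_rtd_one p k c hc B hB m hm.ne_top hPm
    ⟨n, g, hg, hgK, W, le_trans (Nat.le_add_left 1 d) hW, φ, h1, h2, h3⟩

end Summit.ResolutionOfSingularities.ResolutionOfSingularities.Theorems

end
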